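import Literature.MathematicalPhysics.QuantumFieldTheory.MullerSchiemann1987.MS87CentralAngleExpansion
import HarnessLib

/-!
# Müller–Schiemann, *Continuum limit of a hierarchical SU(2) lattice gauge theory in 4 dimensions*
# (CMP 110, 1987), (5.17) FIRST LINE (p.276): «With (4.53) and (5.15), (5.16) follows for J⁽¹⁾,
# |J⁽¹⁾| < exp{(β/2)y² + 𝒪(β^{1−4α})} ∫dv χ₁χ₂ exp{−2β[2 − (uv⁻¹)₀ − v₀]}» — ITS POINTWISE CONTENT PROVED
# with (5.15)/(5.16) DISCHARGED by the sibling `MS87CentralAngleExpansion` ((4.53) stays a hypothesis)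

statement-level skeleton of published theorems with citation tags; proofs where landed; nothing here is a claim about the Yang–Mills mass gap

**Citation header (reproduction of PUBLISHED work).** V. F. Müller, J. Schiemann, *Continuum limit of a hierarchical
SU(2) lattice gauge theory in 4 dimensions*, Commun. Math. Phys. **110** (1987) 261–286, doi 10.1007/BF01207367
[MullerSchiemann1987]; (4.53) p.274, (5.11), (5.15)–(5.17) p.276 (held Project Euclid scan `paper:url-96df5da18d4c`;
displays read by this seat on its own 3× page renders `run/shared/lean/pub/lit-balaban/lit-balaban-p12/renders-cmp110ms/`).
Lean lane of the lit-balaban YM LIT SWEEP CONTEXT row X1 (register level; zero weight for any token of that table); the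
model is the `d = 4` HIERARCHICAL `SU(2)` gauge model, NOT lattice Yang–Mills.  Third of three siblings on Sect. 5:
`MS87NonperturbativeBound` ((5.10)–(5.14), (5.17) lines 2–3 as an identity, (5.21)–(5.25)), `MS87CentralAngleExpansion`
((5.15)/(5.16) quantitative), and this file (the first inequality of (5.17), pointwise in `v`).

**What the paper prints (p.276).** (4.53) p.274: *«h(θ) = exp{−βθ² + 𝒪(β^{1−4α})}»* (in the small field region
`|θ| < β^{−α}`); (5.11): `J⁽¹⁾ := ∫dv χ₁χ₂ h(θ₁)h(θ₂)` with `θ₁² = θ²(uv⁻¹, (i/2)y)`, `θ₂² = θ²(v, (i/2)y)` ((5.8)–(5.9));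
(5.15)–(5.16): `Re θ₁² = 2[1 − (uv⁻¹)₀] − ¼y² + 𝒪(β^{−4α})`, `Re θ₂² = 2[1 − v₀] − ¼y² + 𝒪(β^{−4α})`; (5.17) first line:
*«With (4.53) and (5.15), (5.16) follows for J⁽¹⁾, |J⁽¹⁾| < exp{(β/2)y² + 𝒪(β^{1−4α})} ∫dv χ₁χ₂ exp{−2β[2 − (uv⁻¹)₀ − v₀]}»*.

**What this file proves (kernel-checked, 0 sorry, standard axioms; theorems only).** `eq517_pointwise`: for
`u, v ∈ G = SU(2)`, `t ∈ ℝ` (print: `t = y/2`), `β ≥ 0`, in the small-field regime `(1 − (uv⁻¹)₀) + t² ≤ ¼`,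
`(1 − v₀) + t² ≤ ¼` (the supports of `χ₁`, `χ₂` for `β` large), and two complex numbers `F₁ = h(θ₁)`, `F₂ = h(θ₂)` obeying
(4.53) in modulus form `|F_j| ≤ exp{−β Re θ_j² + E}` (`E` = the `𝒪(β^{1−4α})`):
`|F₁F₂| ≤ exp{2βt² + 7β s₁² + 7β s₂² + 2E} · exp{−2β[2 − (uv⁻¹)₀ − v₀]}`, `s₁ = (1 − (uv⁻¹)₀) + t²`, `s₂ = (1 − v₀) + t²` —
i.e. the integrand of (5.11) is bounded by the integrand of (5.17)'s first line times `exp{(β/2)y² + R}` with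
`R = 7β(s₁² + s₂²) + 2E` (`= 𝒪(β^{1−4α})` in the print's region `s_j = 𝒪(β^{−2α})`); the `Re θ_j²` lower bounds are
the sibling's THEOREM `ThetaSqExpansion.re_thetaSq_mul_I` — (5.15)/(5.16) are no longer hypotheses here.
`eq517_pointwise_y` restates it with `t = y/2` (`2βt² = (β/2)y²`).
* (v1.1, §2) **(5.22) AND (5.23), POINTWISE IN `v`** (p.277: «In the small field region we use (4.53) together with (5.15)
  and (5.16) respectively, discarding the positive terms there. The function g̃ is bounded by the induction assumption
  (A₂). … A bound on J⁽⁴⁾ follows directly from the induction assumption (A₂)»): with (A₂) at `(i/2)y` in modulus form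
  `|g̃(w, (i/2)y)| ≤ exp{β(y/2)² − pβ^{1−2α}}` for the large-field factor(s) and (4.53) + the sibling's `Re θ²` theorem for
  the small-field factor: `|g̃ h(θ₂)| ≤ exp{½βy² − pβ^{1−2α} + 7βs₂² + E}` (`eq522_pointwise`, the exponent of (5.22)
  `½β[y² − pβ^{−2α} − pβ^{−2α}]` plus the explicit `𝒪(β^{1−4α})`), and `|g̃₁g̃₂| ≤ exp{½βy² − 2pβ^{1−2α}}`
  (`eq523_pointwise`, the exponent `½β[y² − pβ^{−2α} − 3pβ^{−2α}]` of (5.23) exactly).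

**History.** v1.0 (lit-balaban-p12 gen 20, p352704): §1. v1.1 (same seat): + §2, append-only.

**Readings (declared).** (4.53) enters as the modulus bound it implies; the cut-offs `χ₁χ₂` are represented by the two
regime hypotheses; the integral over `v` (monotonicity of `∫dv`) is the sibling `MS87NonperturbativeContributionL`'s
`norm_integral_le_of_pointwise` and is not repeated.

**Not claimed.** (4.53) and (A₂) themselves, the remaining lines of (5.17) and the collection (5.24) (siblings), anything
about lattice Yang–Mills or the Clay problem.
-/

open Complex

namespace Literature.MathematicalPhysics.QuantumFieldTheory

namespace MullerSchiemann1987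

namespace Eq517FirstLine

open HeatKernel (u0)
open CentralAngle (thetaSq)
open ThetaSqExpansion (re_thetaSq_mul_I)

/-- **(5.17), FIRST LINE, POINTWISE IN `v`** (see the module docstring): (4.53) for the two factors and the THEOREMS
(5.15)/(5.16) of `MS87CentralAngleExpansion` give
`|h(θ₁)h(θ₂)| ≤ exp{2βt² + 7βs₁² + 7βs₂² + 2E}·exp{−2β[2 − (uv⁻¹)₀ − v₀]}`.
[cite: MullerSchiemann1987, (5.17) first line, (5.15)–(5.16) p.276; (4.53) p.274] -/
theorem eq517_pointwise (u v : Matrix.specialUnitaryGroup (Fin 2) ℂ) {t β E : ℝ} (hβ : 0 ≤ β) {F₁ F₂ : ℂ}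
    (hs₁ : (1 - u0 (u * v⁻¹)) + t ^ 2 ≤ 1 / 4) (hs₂ : (1 - u0 v) + t ^ 2 ≤ 1 / 4)
    (h1 : ‖F₁‖ ≤ Real.exp (-β * (thetaSq (u * v⁻¹) ((t : ℂ) * I)).re + E))
    (h2 : ‖F₂‖ ≤ Real.exp (-β * (thetaSq v ((t : ℂ) * I)).re + E)) :
    ‖F₁ * F₂‖ ≤ Real.exp (2 * β * t ^ 2 + 7 * β * ((1 - u0 (u * v⁻¹)) + t ^ 2) ^ 2 +
        7 * β * ((1 - u0 v) + t ^ 2) ^ 2 + 2 * E) * Real.exp (-2 * β * (2 - u0 (u * v⁻¹) - u0 v)) := by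
  have r1 := re_thetaSq_mul_I (u * v⁻¹) hs₁
  have r2 := re_thetaSq_mul_I v hs₂
  have l1 : 2 * (1 - u0 (u * v⁻¹)) - t ^ 2 - 7 * ((1 - u0 (u * v⁻¹)) + t ^ 2) ^ 2 ≤
      (thetaSq (u * v⁻¹) ((t : ℂ) * I)).re := by linarith [(abs_le.mp r1).1]
  have l2 : 2 * (1 - u0 v) - t ^ 2 - 7 * ((1 - u0 v) + t ^ 2) ^ 2 ≤ (thetaSq v ((t : ℂ) * I)).re := by
    linarith [(abs_le.mp r2).1]
  have m1 := mul_le_mul_of_nonneg_left l1 hβ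
  have m2 := mul_le_mul_of_nonneg_left l2 hβ
  rw [norm_mul, ← Real.exp_add]
  calc ‖F₁‖ * ‖F₂‖ ≤ Real.exp (-β * (thetaSq (u * v⁻¹) ((t : ℂ) * I)).re + E) *
        Real.exp (-β * (thetaSq v ((t : ℂ) * I)).re + E) :=
        mul_le_mul h1 h2 (norm_nonneg _) (Real.exp_pos _).le
    _ = Real.exp ((-β * (thetaSq (u * v⁻¹) ((t : ℂ) * I)).re + E) + (-β * (thetaSq v ((t : ℂ) * I)).re + E)) :=
        (Real.exp_add _ _).symm
    _ ≤ _ := Real.exp_le_exp.mpr (by linarith)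

/-- The same with `t = y/2`: the prefactor is `exp{(β/2)y² + R}`, `R = 7β(s₁² + s₂²) + 2E`, as in the print's
«exp{(β/2)y² + 𝒪(β^{1−4α})}». [cite: MullerSchiemann1987, (5.17) first line p.276] -/
theorem eq517_pointwise_y (u v : Matrix.specialUnitaryGroup (Fin 2) ℂ) {y β E : ℝ} (hβ : 0 ≤ β) {F₁ F₂ : ℂ}
    (hs₁ : (1 - u0 (u * v⁻¹)) + (y / 2) ^ 2 ≤ 1 / 4) (hs₂ : (1 - u0 v) + (y / 2) ^ 2 ≤ 1 / 4)
    (h1 : ‖F₁‖ ≤ Real.exp (-β * (thetaSq (u * v⁻¹) (((y / 2 : ℝ) : ℂ) * I)).re + E))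
    (h2 : ‖F₂‖ ≤ Real.exp (-β * (thetaSq v (((y / 2 : ℝ) : ℂ) * I)).re + E)) :
    ‖F₁ * F₂‖ ≤ Real.exp (β / 2 * y ^ 2 + (7 * β * ((1 - u0 (u * v⁻¹)) + (y / 2) ^ 2) ^ 2 +
        7 * β * ((1 - u0 v) + (y / 2) ^ 2) ^ 2 + 2 * E)) * Real.exp (-2 * β * (2 - u0 (u * v⁻¹) - u0 v)) := by
  have h := eq517_pointwise u v hβ hs₁ hs₂ h1 h2
  have e : 2 * β * (y / 2) ^ 2 + 7 * β * ((1 - u0 (u * v⁻¹)) + (y / 2) ^ 2) ^ 2 +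
      7 * β * ((1 - u0 v) + (y / 2) ^ 2) ^ 2 + 2 * E =
      β / 2 * y ^ 2 + (7 * β * ((1 - u0 (u * v⁻¹)) + (y / 2) ^ 2) ^ 2 +
        7 * β * ((1 - u0 v) + (y / 2) ^ 2) ^ 2 + 2 * E) := by ring
  rw [e] at h
  exact h


/-! ## §2 (v1.1) (5.22) and (5.23), pointwise in `v` -/

/-- `β · β^{−2α} = β^{1−2α}` (`β > 0`). [folklore] -/
private theorem mul_rpow_neg {β t : ℝ} (hβ : 0 < β) : β * β ^ (-t) = β ^ (1 - t) := by
  rw [sub_eq_add_neg, Real.rpow_add hβ, Real.rpow_one]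

/-- **(5.22), POINTWISE**: one factor bounded by (A₂) at `(i/2)y`, `|G| ≤ exp{β(y/2)² − pβ^{1−2α}}`, the other by (4.53)
with (5.16) «discarding the positive terms there» (`Re θ₂² ≥ −(y/2)² − 7s₂²`, the sibling's theorem):
`|G·h(θ₂)| ≤ exp{½βy² − pβ^{1−2α} + 7βs₂² + E}`, `s₂ = (1 − v₀) + (y/2)²` — the exponent `½β[y² − pβ^{−2α} − pβ^{−2α}]` of
(5.22) plus the explicit `𝒪(β^{1−4α})` term. (For `J⁽³⁾` exchange the roles of the two factors.)
[cite: MullerSchiemann1987, (5.22) p.277] -/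
theorem eq522_pointwise (v : Matrix.specialUnitaryGroup (Fin 2) ℂ) {y β p α E : ℝ} (hβ : 0 < β) {G F : ℂ}
    (hs : (1 - u0 v) + (y / 2) ^ 2 ≤ 1 / 4)
    (hA2 : ‖G‖ ≤ Real.exp (β * (y / 2) ^ 2 - p * β ^ (1 - 2 * α)))
    (h453 : ‖F‖ ≤ Real.exp (-β * (thetaSq v (((y / 2 : ℝ) : ℂ) * I)).re + E)) :
    ‖G * F‖ ≤ Real.exp (β / 2 * (y ^ 2 - p * β ^ (-(2 * α)) - p * β ^ (-(2 * α))) +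
      (7 * β * ((1 - u0 v) + (y / 2) ^ 2) ^ 2 + E)) := by
  have r := re_thetaSq_mul_I v hs
  have hu0 := abs_le.mp (HeatKernel.abs_u0_le_one v)
  have l : -(y / 2) ^ 2 - 7 * ((1 - u0 v) + (y / 2) ^ 2) ^ 2 ≤ (thetaSq v (((y / 2 : ℝ) : ℂ) * I)).re := by
    linarith [(abs_le.mp r).1, hu0.2]
  have m := mul_le_mul_of_nonneg_left l hβ.le
  have hβs : β * β ^ (-(2 * α)) = β ^ (1 - 2 * α) := mul_rpow_neg hβ
  rw [norm_mul]
  calc ‖G‖ * ‖F‖ ≤ Real.exp (β * (y / 2) ^ 2 - p * β ^ (1 - 2 * α)) *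
        Real.exp (-β * (thetaSq v (((y / 2 : ℝ) : ℂ) * I)).re + E) :=
        mul_le_mul hA2 h453 (norm_nonneg _) (Real.exp_pos _).le
    _ = Real.exp ((β * (y / 2) ^ 2 - p * β ^ (1 - 2 * α)) + (-β * (thetaSq v (((y / 2 : ℝ) : ℂ) * I)).re + E)) :=
        (Real.exp_add _ _).symm
    _ ≤ _ := Real.exp_le_exp.mpr (by
        have e : β / 2 * (y ^ 2 - p * β ^ (-(2 * α)) - p * β ^ (-(2 * α))) =
            β / 2 * y ^ 2 - p * (β * β ^ (-(2 * α))) := by ring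
        rw [e, hβs]; linarith)

/-- **(5.23), POINTWISE**: both factors bounded by (A₂) at `(i/2)y`: `|G₁G₂| ≤ exp{½βy² − 2pβ^{1−2α}}
= exp{½β[y² − pβ^{−2α} − 3pβ^{−2α}]}` — «A bound on J⁽⁴⁾ follows directly from the induction assumption (A₂)».
[cite: MullerSchiemann1987, (5.23) p.277] -/
theorem eq523_pointwise {y β p α : ℝ} (hβ : 0 < β) {G₁ G₂ : ℂ}
    (h1 : ‖G₁‖ ≤ Real.exp (β * (y / 2) ^ 2 - p * β ^ (1 - 2 * α)))
    (h2 : ‖G₂‖ ≤ Real.exp (β * (y / 2) ^ 2 - p * β ^ (1 - 2 * α))) :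
    ‖G₁ * G₂‖ ≤ Real.exp (β / 2 * (y ^ 2 - p * β ^ (-(2 * α)) - 3 * p * β ^ (-(2 * α)))) := by
  have hβs : β * β ^ (-(2 * α)) = β ^ (1 - 2 * α) := mul_rpow_neg hβ
  rw [norm_mul]
  calc ‖G₁‖ * ‖G₂‖ ≤ Real.exp (β * (y / 2) ^ 2 - p * β ^ (1 - 2 * α)) *
        Real.exp (β * (y / 2) ^ 2 - p * β ^ (1 - 2 * α)) :=
        mul_le_mul h1 h2 (norm_nonneg _) (Real.exp_pos _).le
    _ = Real.exp ((β * (y / 2) ^ 2 - p * β ^ (1 - 2 * α)) + (β * (y / 2) ^ 2 - p * β ^ (1 - 2 * α))) :=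
        (Real.exp_add _ _).symm
    _ = _ := by
        congr 1
        have e : β / 2 * (y ^ 2 - p * β ^ (-(2 * α)) - 3 * p * β ^ (-(2 * α))) =
            β / 2 * y ^ 2 - 2 * p * (β * β ^ (-(2 * α))) := by ring
        rw [e, hβs]; ring

end Eq517FirstLine

end MullerSchiemann1987

end Literature.MathematicalPhysics.QuantumFieldTheory
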